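import Summits.BirchSwinnertonDyer.BirchSwinnertonDyer.Theorems.PAdicOrderV2PadicBSDrankOfItemsAtTwo
import Literature.NumberTheory.EllipticCurves.OrdinaryPrimesProofs

set_option linter.dupNamespace false

/-!
# Crux-strategist census file for crux #3 `PAdicOrderPadicBSDrankR2` (stmt-BirchSwinnertonDyer-0490)

Scratch evidence for `STRATEGY-CENSUS.md` (unit `cstrat-stmt-BirchSwinnertonDyer-0490-s1`, 2026-08-17).
Nothing here is route structure; it only TYPES the census entries over existing declarations and
kernel-checks the glue of the candidate decompositions against the landed theorems of line `Sketch`.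

Crux (fixed): `PAdicOrderPadicBSDrankR2` — at EVERY good ordinary prime `p` (`p = 2` included) and
for the newform `f` of `E`: `ord_{T=0} L_p(f, α_p, T) = rank E(ℚ)`.

* § Decomposition — the three typed cuts examined in the census:
  (P) parity partition `OddCore ∧ ResidueTwo ↔ crux` (exact, trivial seam);
  (M) mechanism cut `SelmerRankShaPFinite → OrderEqSelmerCorankOdd → ResidueTwo → crux`
      (Ш-leg / IMC+semisimplicity-leg / `p = 2` window), glue PROVED;
  (A) the lead's items-only cut `R7 → 0509 → 0132 → 0489 → crux` (landed p138121), whose pieces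
      are top-level items of the same route (not re-filable as children).
  Each piece is reduced to EXISTING route items by a landed theorem (`…_of_items` below).
* § Strengthen / weaken — the candidate S⁺ / S⁻ statements as `Prop`s that elaborate, with the
  trivial implications that place them relative to the crux.
-/

namespace Summit.BirchSwinnertonDyer.BirchSwinnertonDyer.Cruxes.PAdicOrderPadicBSDrankR2.Strategist

open scoped MatrixGroups ModularForm
open CongruenceSubgroup Literature.NumberTheory.EllipticCurves
  Literature.NumberTheory.EllipticCurves.ModularForms
open Summit.BirchSwinnertonDyer.BirchSwinnertonDyer.Theses.PAdicOrderV2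
open Summit.BirchSwinnertonDyer.BirchSwinnertonDyer.Theses.SelmerRank (SelmerRankShaPFinite)
open Summit.BirchSwinnertonDyer.BirchSwinnertonDyer.Theorems

/-! ## § Decomposition (P): the parity partition -/

/-- Sub (P1) `OddCore`: the crux at every ODD good ordinary prime — the slice the route's glue
`CruxesToThesis` consumes (`5 ≤ p`) and the repair form of kill criterion (c) (`p ≠ 2 →`).
Reducible to the three route items 15426 ∧ 0509 ∧ 0132 (`oddCore_of_items`). [folklore] -/
def OddCore : Prop :=
  ∀ (W : WeierstrassCurve ℚ) [W.IsElliptic] [W.IsGloballyMinimal] (p : ℕ) [Fact p.Prime], p ≠ 2 →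
    IsOrdinaryAt W p → ∀ {N : ℕ} [NeZero N] (f : CuspForm (Gamma0 N) 2), IsNewformOf W f →
      (padicLFunction f (unitRoot W p : ℚ_[p])).order = W.mordellWeilRank

/-- Sub (P2) `ResidueTwo`: the crux at a good ordinary `p = 2` (`a_2` odd) — MTT BSD(2)(i), the
one slice no printed theorem reaches (no main conjecture at `2`); the disprover's only window.
[folklore] -/
def ResidueTwo : Prop :=
  ∀ (W : WeierstrassCurve ℚ) [W.IsElliptic] [W.IsGloballyMinimal] (p : ℕ) [Fact p.Prime], p = 2 →
    IsOrdinaryAt W p → ∀ {N : ℕ} [NeZero N] (f : CuspForm (Gamma0 N) 2), IsNewformOf W f →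
      (padicLFunction f (unitRoot W p : ℚ_[p])).order = W.mordellWeilRank

/-- Glue (P): `OddCore → ResidueTwo → crux` (case split on `p = 2`). [folklore] -/
theorem crux_of_oddCore_of_residueTwo (h1 : OddCore) (h2 : ResidueTwo) :
    PAdicOrderPadicBSDrankR2 := by
  intro W _ _ p _ hord N _ f hf
  by_cases hp : p = 2
  · exact h2 W p hp hord f hf
  · exact h1 W p hp hord f hf

/-- Converse (P1): the crux gives `OddCore`. [folklore] -/
theorem oddCore_of_crux (h : PAdicOrderPadicBSDrankR2) : OddCore :=
  fun W _ _ p _ _ hord _ _ f hf ↦ h W p hord f hf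

/-- Converse (P2): the crux gives `ResidueTwo`. [folklore] -/
theorem residueTwo_of_crux (h : PAdicOrderPadicBSDrankR2) : ResidueTwo :=
  fun W _ _ p _ _ hord _ _ f hf ↦ h W p hord f hf

/-- Exactness of (P). [folklore] -/
theorem crux_iff_oddCore_and_residueTwo :
    PAdicOrderPadicBSDrankR2 ↔ OddCore ∧ ResidueTwo :=
  ⟨fun h ↦ ⟨oddCore_of_crux h, residueTwo_of_crux h⟩,
    fun h ↦ crux_of_oddCore_of_residueTwo h.1 h.2⟩

/-! ## § Decomposition (M): the mechanism cut (Ш-leg / IMC+semisimplicity-leg / `p = 2`) -/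

/-- Sub (M2) `OrderEqSelmerCorankOdd`: at every ODD good ordinary `p`, `ord_{T=0} L_p(E,T) =
corank_{ℤ_p} Sel_{p^∞}(E/ℚ)` — the `L`-side shadow of [IMC at `(T)`] ∧ [Greenberg Conj. 1.12 at
`T`] ∧ [Mazur control]; reducible to items 15426 ∧ 0509 (`orderEqSelmerCorankOdd_of_items`, the
control theorem being the tree theorem `Greenberg1999_coinvariantsRank_eq_selmerCorank_rat_holds`).
[folklore] -/
def OrderEqSelmerCorankOdd : Prop :=
  ∀ (W : WeierstrassCurve ℚ) [W.IsElliptic] [W.IsGloballyMinimal] (p : ℕ) [Fact p.Prime], p ≠ 2 →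
    IsOrdinaryAt W p → ∀ {N : ℕ} [NeZero N] (f : CuspForm (Gamma0 N) 2), IsNewformOf W f →
      (padicLFunction f (unitRoot W p : ℚ_[p])).order = W.selmerCorank p

/-- Glue (M): `SelmerRankShaPFinite (0132) → OrderEqSelmerCorankOdd → ResidueTwo → crux`, PROVED
(odd `p`: `ord = corank Sel = rank` by the landed `stub_padicBSDrank_rankEqCorankOfShaFinite`;
`p = 2`: the residue). [folklore] -/
theorem crux_of_sha_of_orderEqSelmerCorankOdd_of_residueTwo (hSha : SelmerRankShaPFinite)
    (hOE : OrderEqSelmerCorankOdd) (h2 : ResidueTwo) : PAdicOrderPadicBSDrankR2 := by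
  refine crux_of_oddCore_of_residueTwo ?_ h2
  intro W _ _ p _ hp hord N _ f hf
  rw [hOE W p hp hord f hf, stub_padicBSDrank_rankEqCorankOfShaFinite W p (hSha W p)]

/-! ## The pieces from the EXISTING route items (why no piece is new work) -/

/-- (P1) from the items 15426 ∧ 0509 ∧ 0132 (= landed `padicBSDrank_odd_of_items`). [folklore] -/
theorem oddCore_of_items (hMC : PAdicOrderMainConjectureR7) (hSS : PAdicOrderSemisimpleR3)
    (hSha : SelmerRankShaPFinite) : OddCore :=
  fun W _ _ p _ hp hord _ _ f hf ↦ padicBSDrank_odd_of_items hMC hSS hSha W p hp hord f hf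

/-- (M2) from the items 15426 ∧ 0509 (= landed `stub_padicBSDrank_orderEqCorankOdd` fed with the
tree's control theorem). [folklore] -/
theorem orderEqSelmerCorankOdd_of_items (hMC : PAdicOrderMainConjectureR7)
    (hSS : PAdicOrderSemisimpleR3) : OrderEqSelmerCorankOdd :=
  fun W _ _ p _ hp hord _ _ f hf ↦
    stub_padicBSDrank_orderEqCorankOdd hMC hSS
      Greenberg1999_coinvariantsRank_eq_selmerCorank_rat_holds W p hp hord f hf

/-- (P2) from the items 15426 ∧ 0509 ∧ 0132 ∧ crux #2 0489 (= landed
`pAdicOrderPadicBSDrankR2_of_items_of_comparison`, p138121): the `p = 2` residue of crux #3 is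
contained in crux #2's. [folklore] -/
theorem residueTwo_of_items_of_comparison (hMC : PAdicOrderMainConjectureR7)
    (hSS : PAdicOrderSemisimpleR3) (hSha : SelmerRankShaPFinite) (hCmp : PAdicOrderComparisonR2) :
    ResidueTwo :=
  residueTwo_of_crux (pAdicOrderPadicBSDrankR2_of_items_of_comparison hMC hSS hSha hCmp)

/-- Decomposition (A) restated: the whole crux from the four route items, no residue at all
(landed p138121). [folklore] -/
theorem crux_of_four_route_items (hMC : PAdicOrderMainConjectureR7) (hSS : PAdicOrderSemisimpleR3)
    (hSha : SelmerRankShaPFinite) (hCmp : PAdicOrderComparisonR2) : PAdicOrderPadicBSDrankR2 :=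
  pAdicOrderPadicBSDrankR2_of_items_of_comparison hMC hSS hSha hCmp

/-! ## § Strengthen / weaken — typed candidates -/

/-- S⁻_one (the ROUTE-RELEVANT weakening): MTT BSD(p)(i) at ONE good ordinary `p ≥ 5` per curve —
all that the thesis `X` (`PAdicOrderThesisR2`, `∃ p`) consumes of crux #3. [folklore] -/
def PadicBSDrankAtOnePrime : Prop :=
  ∀ (W : WeierstrassCurve ℚ) [W.IsElliptic] [W.IsGloballyMinimal], ∃ (p : ℕ) (_ : Fact p.Prime),
    5 ≤ p ∧ IsOrdinaryAt W p ∧ ∀ {N : ℕ} [NeZero N] (f : CuspForm (Gamma0 N) 2), IsNewformOf W f →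
      (padicLFunction f (unitRoot W p : ℚ_[p])).order = W.mordellWeilRank

/-- S⁻_cof ("horizontal" form): for each curve, MTT BSD(p)(i) at all but finitely many good
ordinary `p`. Weaker than the crux in the `p`-aspect; still open in positive rank (a Wieferich-type
statement about `σ_p`-values, cf. Greenberg LNM 1716 Prop. 5.1 for rank 0). [folklore] -/
def PadicBSDrankAlmostAllPrimes : Prop :=
  ∀ (W : WeierstrassCurve ℚ) [W.IsElliptic] [W.IsGloballyMinimal], ∃ P₀ : ℕ, ∀ (p : ℕ) [Fact p.Prime],
    P₀ ≤ p → IsOrdinaryAt W p → ∀ {N : ℕ} [NeZero N] (f : CuspForm (Gamma0 N) 2), IsNewformOf W f →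
      (padicLFunction f (unitRoot W p : ℚ_[p])).order = W.mordellWeilRank

/-- S⁺_ss (strengthening of the semisimplicity leg): Greenberg's Conj. 1.12 at `T` at EVERY good
ordinary prime, `p = 2` INCLUDED — item 0509's body with its parity guard dropped (= 0509 ∧ SS₂).
[folklore] -/
def SemisimpleAtTAllPrimes : Prop :=
  ∀ (W : WeierstrassCurve ℚ) [W.IsElliptic] [W.IsGloballyMinimal] (p : ℕ) [Fact p.Prime],
    W.HasGoodReductionAtPrime p → ¬ (p : ℤ) ∣ W.frobeniusTrace p →
    ∀ (κ : ZpExtension ℚ p) (γ : Field.absoluteGaloisGroup ℚ), κ.IsCyclotomic → κ.IsTopGenerator γ →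
    ∀ (D : W.SelmerDualData κ γ) (x : D.X),
      (∃ k : ℕ, (PowerSeries.C ((p : ℤ_[p]) ^ k) * PowerSeries.X ^ 2 : IwasawaAlgebra p) • x = 0) →
        ∃ k : ℕ, (PowerSeries.C ((p : ℤ_[p]) ^ k) * PowerSeries.X : IwasawaAlgebra p) • x = 0

/-- S_rig ("small excess", the only rigidity in print): at a good ordinary `p`, if
`ord_T L_p ≤ rank + 1` then `ord_T L_p = rank` — excess zeros come in PAIRS (p-adic functional
equation / alternating derived heights), so an excess of one is impossible given `Ш[p^∞]` finite and
`p`-parity. Typed as a target; it is parity, not leverage on excess `≥ 2`. [folklore] -/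
def SmallExcess : Prop :=
  ∀ (W : WeierstrassCurve ℚ) [W.IsElliptic] [W.IsGloballyMinimal] (p : ℕ) [Fact p.Prime],
    IsOrdinaryAt W p → ∀ {N : ℕ} [NeZero N] (f : CuspForm (Gamma0 N) 2), IsNewformOf W f →
      (padicLFunction f (unitRoot W p : ℚ_[p])).order ≤ (W.mordellWeilRank + 1 : ℕ) →
      (padicLFunction f (unitRoot W p : ℚ_[p])).order = W.mordellWeilRank

/-- The crux implies its one-prime weakening (a good ordinary `p ≥ 5` exists for every curve:
`WeierstrassCurve.exists_good_ordinary_prime_holds`). [folklore] -/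
theorem atOnePrime_of_crux (h : PAdicOrderPadicBSDrankR2) : PadicBSDrankAtOnePrime := by
  intro W _ _
  obtain ⟨q, hq, h5, hgood, hordq⟩ := WeierstrassCurve.exists_good_ordinary_prime_holds W
  exact ⟨q, hq, h5, ⟨hgood, hordq⟩, fun f hf ↦ h W q ⟨hgood, hordq⟩ f hf⟩

/-- `OddCore` alone already implies the one-prime weakening — the thesis never needed `p = 2`.
[folklore] -/
theorem atOnePrime_of_oddCore (h : OddCore) : PadicBSDrankAtOnePrime := by
  intro W _ _
  obtain ⟨q, hq, h5, hgood, hordq⟩ := WeierstrassCurve.exists_good_ordinary_prime_holds W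
  exact ⟨q, hq, h5, ⟨hgood, hordq⟩, fun f hf ↦ h W q (by omega) ⟨hgood, hordq⟩ f hf⟩

/-- Hence the one-prime weakening follows from the three Selmer-side items alone (no crux #2, no
`p = 2`). [folklore] -/
theorem atOnePrime_of_items (hMC : PAdicOrderMainConjectureR7) (hSS : PAdicOrderSemisimpleR3)
    (hSha : SelmerRankShaPFinite) : PadicBSDrankAtOnePrime :=
  atOnePrime_of_oddCore (oddCore_of_items hMC hSS hSha)

/-- The crux implies the cofinite form (take `P₀ = 0`). [folklore] -/
theorem almostAllPrimes_of_crux (h : PAdicOrderPadicBSDrankR2) : PadicBSDrankAlmostAllPrimes :=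
  fun W _ _ ↦ ⟨0, fun p _ _ hord _ _ f hf ↦ h W p hord f hf⟩

/-- The crux implies the small-excess form trivially (recorded so the census's S_rig is placed).
[folklore] -/
theorem smallExcess_of_crux (h : PAdicOrderPadicBSDrankR2) : SmallExcess :=
  fun W _ _ p _ hord _ _ f hf _ ↦ h W p hord f hf

/-- S⁺_ss restricts to item 0509 (drop to odd `p`). [folklore] -/
theorem semisimpleR3_of_semisimpleAtTAllPrimes (h : SemisimpleAtTAllPrimes) :
    PAdicOrderSemisimpleR3 :=
  fun W _ _ p _ _ hgood hord κ γ hκ hγ D x hx ↦ h W p hgood hord κ γ hκ hγ D x hx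


/-! ## § Actionable 1 (tenure recipe, kernel-checked): the thesis X no longer needs crux #3 -/

/-- The route-level re-glue this census recommends, typed: modularity (inlined exactly as in the
route's support item `CruxesToThesis`, stmt-14877) → crux #2 → item 15426 → item 0509 → item 0132 →
thesis `PAdicOrderThesisR2`. PROVED: at a good ordinary `p ≥ 5` (exists), crux #2 gives
`ord_T L_p = r_an` and the three Selmer-side items give `ord_T L_p = rank`
(`padicBSDrank_five_le_of_items`, landed p137902). So crux #3 is not load-bearing for `closes`.
[folklore] -/
def CruxesToThesisV3 : Prop :=
  (∀ (W : WeierstrassCurve ℚ) [W.IsElliptic] [NeZero (W.conductorNorm ℤ)],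
      ∃ f : CuspForm (Gamma0 (W.conductorNorm ℤ)) 2, IsNewformOf W f) →
    PAdicOrderComparisonR2 → PAdicOrderMainConjectureR7 → PAdicOrderSemisimpleR3 →
    SelmerRankShaPFinite → PAdicOrderThesisR2

/-- `CruxesToThesisV3` holds (no crux #3). [folklore] -/
theorem cruxesToThesisV3_holds : CruxesToThesisV3 := by
  intro hmod h2 hMC hSS hSha W _ _
  obtain ⟨p, hp, h5, hgood, hord⟩ := WeierstrassCurve.exists_good_ordinary_prime_holds W
  haveI hN : NeZero (W.conductorNorm ℤ) := ⟨(W.conductorNorm_pos_holds).ne'⟩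
  obtain ⟨f, hf⟩ := hmod W
  have hO : IsOrdinaryAt W p := ⟨hgood, hord⟩
  exact ⟨p, hp, hO, W.conductorNorm ℤ, hN, f, hf, h2 W p hO f hf,
    padicBSDrank_five_le_of_items hMC hSS hSha W p h5 hO f hf⟩

/-- And the route's existing glue item follows from V3 plus crux #3's `5 ≤ p` slice — i.e. V3 is
a drop-in replacement (sanity check of the recipe's direction). [folklore] -/
theorem thesis_of_items_of_comparison
    (hmod : ∀ (W : WeierstrassCurve ℚ) [W.IsElliptic] [NeZero (W.conductorNorm ℤ)],
      ∃ f : CuspForm (Gamma0 (W.conductorNorm ℤ)) 2, IsNewformOf W f)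
    (h2 : PAdicOrderComparisonR2) (hMC : PAdicOrderMainConjectureR7)
    (hSS : PAdicOrderSemisimpleR3) (hSha : SelmerRankShaPFinite) : PAdicOrderThesisR2 :=
  cruxesToThesisV3_holds hmod h2 hMC hSS hSha

end Summit.BirchSwinnertonDyer.BirchSwinnertonDyer.Cruxes.PAdicOrderPadicBSDrankR2.Strategist
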